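import Mathlib.MeasureTheory.Measure.Haar.Unique
import Literature.MathematicalPhysics.KineticTheory.HardSphereEulerLLN
import Literature.Analysis.FluidPDE.HardSpherePhaseSpaceProofs

/-!
# Mesoscopic LLN for local Gibbs states — IV: translates under the canonical gas (Fubini forms)

Helper file for item stmt-AtomisticToContinuum-9524 (`MesoscopicLLN`).

For a continuous kernel `φ` on `𝕋³` and the canonical hard-sphere quantities of
`HardSphereCanonicalTorus` evaluated at the translates `φ(· - x)`:

* measurability and boundedness in the translation parameter `x` of `W^{φ(·-x)}(k)`,
  `M^{φ(·-x)}(m)` and of the two-point numerator (parametric integrals);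
* **Fubini forms**: `∫ w(x) M^{φ(·-x)}(m) dx = M^{w ⋆ φ}(m)` with `(w ⋆ φ)(a) = ∫ w(x) φ(a - x) dx`
  (`integral_mul_Md_translate`), in particular `∫ M^{φ(·-x)}(m) dx = Ξ(m)` for a kernel of mass
  one, and the one-point versions `∫ w(x) E[φ(x₀ - x)] dx = E[(w ⋆ φ)(x₀)]`;
* the same-block remainder bound of `HardSphereEulerLLN.tendsto_sameBlockRem_div`, extracted with
  two different observables: `|same-block| / Ξ_N(N+1) ≤ 4 e² C C' S p_{ε_N}`
  (`abs_sameBlockRem_div_le`).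

References: Pulvirenti–Tsagkarogiannis 2012 §3; Spohn 1991, Part I §2.3.
-/

namespace Summit.AtomisticToContinuum.HydrodynamicLimit.Theorems.MesoLLN

open MeasureTheory ProbabilityTheory Finset Filter Topology
open Literature.Probability.LatticeModels Literature.MathematicalPhysics.StatisticalMechanics
open Literature.MathematicalPhysics.KineticTheory
open Literature.Analysis.FluidPDE (Config)
open Literature.Analysis.FluidPDE.Torus (euclidDist reprSym)
open Literature.Analysis.FunctionSpaces (Torus.proj)
open scoped ENNReal

noncomputable section

variable {P : DensityProfile} {ε σ : ℝ} {n : ℕ}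

/-! ### Parametric integrals over the canonical gas -/

/-- A parametric integral of a jointly measurable function against the product law is measurable
in the parameter. -/
theorem measurable_integral_param {G : T3 → (Fin n → T3) → ℝ}
    (hG : Measurable (Function.uncurry G)) :
    Measurable fun x => ∫ y, G x y ∂Measure.pi (fun _ : Fin n => P.μ) :=
  (hG.stronglyMeasurable.integral_prod_right
    (ν := Measure.pi (fun _ : Fin n => P.μ))).measurable

/-- A parametric integral of a bounded function against the product (probability) law is bounded
by the same constant. -/
theorem abs_integral_param_le {G : T3 → (Fin n → T3) → ℝ} {B : ℝ} (hB : ∀ x y, |G x y| ≤ B)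
    (x : T3) : |∫ y, G x y ∂Measure.pi (fun _ : Fin n => P.μ)| ≤ B := by
  have hB0 : 0 ≤ B := (abs_nonneg _).trans (hB x fun _ => 0)
  refine (Real.norm_eq_abs _).symm.trans_le ((norm_integral_le_of_norm_le_const
    (ae_of_all _ fun y => ?_)).trans_eq (by rw [probReal_univ, mul_one]))
  rw [Real.norm_eq_abs]; exact hB x y

/-- The translation map `(x, y) ↦ yᵢ - x` is measurable. -/
theorem measurable_apply_sub (i : Fin n) :
    Measurable fun p : T3 × (Fin n → T3) => p.2 i - p.1 :=
  ((measurable_pi_apply i).comp measurable_snd).sub measurable_fst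

variable {φ : T3 → ℝ}

/-- `x ↦ W^{φ(·-x)}(k)` is measurable. -/
theorem measurable_Wd_translate [NeZero n] (hφ : Measurable φ) (k : ℕ) :
    Measurable fun x => Wd P ε n (fun y => φ (y - x)) k := by
  unfold Wd decAct
  refine measurable_integral_param ?_
  exact (hφ.comp (measurable_apply_sub 0)).mul
    ((measurable_uR (measurableSet_ov ε) _).comp measurable_snd)

/-- `x ↦ M^{φ(·-x)}(m)` is measurable. -/
theorem measurable_Md_translate [NeZero n] (hφ : Measurable φ) (m : ℕ) :
    Measurable fun x => Md P ε n (fun y => φ (y - x)) m := by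
  unfold Md decPF
  refine measurable_integral_param ?_
  exact (hφ.comp (measurable_apply_sub 0)).mul
    ((measurable_efR (measurableSet_ov ε) _).comp measurable_snd)

/-- `x ↦ ∫ φ(y₀ - x) φ(y₁ - x) 𝟙[hard core] dμ^{⊗n}` is measurable. -/
theorem measurable_twoPtNum_translate [NeZero n] (hφ : Measurable φ) (h2 : 2 ≤ n) :
    Measurable fun x => ∫ y, φ (y 0 - x) * φ (y ⟨1, h2⟩ - x) * efR (Ov ε) y univ
      ∂Measure.pi (fun _ : Fin n => P.μ) := by
  refine measurable_integral_param ?_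
  exact ((hφ.comp (measurable_apply_sub 0)).mul (hφ.comp (measurable_apply_sub ⟨1, h2⟩))).mul
    ((measurable_efR (measurableSet_ov ε) _).comp measurable_snd)

/-- `|M^{φ(·-x)}(m)| ≤ K` for `|φ| ≤ K`. -/
theorem abs_Md_translate_le [NeZero n] {K : ℝ} (hφK : ∀ y, |φ y| ≤ K) (m : ℕ) (x : T3) :
    |Md P ε n (fun y => φ (y - x)) m| ≤ K := by
  have hK : 0 ≤ K := (abs_nonneg _).trans (hφK 0)
  unfold Md decPF
  refine abs_integral_param_le (G := fun x y => φ (y 0 - x) * efR (Ov ε) y (firstLabels n m))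
    (fun x y => ?_) x
  rw [abs_mul]
  calc |φ (y 0 - x)| * |efR (Ov ε) y (firstLabels n m)| ≤ K * 1 :=
        mul_le_mul (hφK _) (abs_efR_le_one y _) (abs_nonneg _) hK
    _ = K := mul_one K

/-- The two-point numerator of a translate is bounded by `K²`. -/
theorem abs_twoPtNum_translate_le [NeZero n] {K : ℝ} (hφK : ∀ y, |φ y| ≤ K) (h2 : 2 ≤ n) (x : T3) :
    |∫ y, φ (y 0 - x) * φ (y ⟨1, h2⟩ - x) * efR (Ov ε) y univ ∂Measure.pi (fun _ : Fin n => P.μ)| ≤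
      K * K := by
  have hK : 0 ≤ K := (abs_nonneg _).trans (hφK 0)
  refine abs_integral_param_le
    (G := fun x y => φ (y 0 - x) * φ (y ⟨1, h2⟩ - x) * efR (Ov ε) y univ) (fun x y => ?_) x
  rw [abs_mul, abs_mul]
  calc |φ (y 0 - x)| * |φ (y ⟨1, h2⟩ - x)| * |efR (Ov ε) y univ| ≤ K * K * 1 :=
        mul_le_mul (mul_le_mul (hφK _) (hφK _) (abs_nonneg _) hK) (abs_efR_le_one y _)
          (abs_nonneg _) (mul_nonneg hK hK)
    _ = K * K := mul_one _

/-! ### Fubini forms -/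

/-- The Haar probability measure of `𝕋³` is invariant under negation (abelian compact group);
local copy for this file. -/
theorem isNegInvariant_volume_T3' : (volume : Measure T3).IsNegInvariant :=
  Measure.IsAddHaarMeasure.isNegInvariant_of_regular (volume : Measure T3)

/-- **Fubini for a weighted translate**: for continuous `w`, `φ` on `𝕋³`,
`∫ w(x) M^{φ(·-x)}(m) dx = M^{w ⋆ φ}(m)` with `(w ⋆ φ)(a) = ∫ w(x) φ(a - x) dx`. -/
theorem integral_mul_Md_translate [NeZero n] {w : T3 → ℝ} (hw : Continuous w) (hφ : Continuous φ)
    (m : ℕ) :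
    ∫ x, w x * Md P ε n (fun y => φ (y - x)) m =
      Md P ε n (fun a => ∫ x, w x * φ (a - x)) m := by
  obtain ⟨Cw, hCw0, hCw⟩ := exists_forall_abs_le_of_continuous hw
  obtain ⟨K, hK0, hK⟩ := exists_forall_abs_le_of_continuous hφ
  set μn := Measure.pi (fun _ : Fin n => P.μ) with hμn
  have hO := measurableSet_ov ε
  -- the joint integrand
  set G : T3 → (Fin n → T3) → ℝ := fun x y => w x * φ (y 0 - x) * efR (Ov ε) y (firstLabels n m)
    with hG
  have hGm : Measurable (Function.uncurry G) :=
    ((hw.measurable.comp measurable_fst).mul (hφ.measurable.comp (measurable_apply_sub 0))).mul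
      ((measurable_efR hO _).comp measurable_snd)
  have hGb : ∀ x y, |G x y| ≤ Cw * K := fun x y => by
    rw [hG]; dsimp only
    rw [abs_mul, abs_mul]
    calc |w x| * |φ (y 0 - x)| * |efR (Ov ε) y (firstLabels n m)| ≤ Cw * K * 1 :=
          mul_le_mul (mul_le_mul (hCw _) (hK _) (abs_nonneg _) hCw0) (abs_efR_le_one y _)
            (abs_nonneg _) (mul_nonneg hCw0 hK0)
      _ = Cw * K := mul_one _
  have hGi : Integrable (Function.uncurry G) ((volume : Measure T3).prod μn) := by
    refine (integrable_const (Cw * K)).mono' hGm.aestronglyMeasurable (ae_of_all _ fun p => ?_)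
    rw [Real.norm_eq_abs]
    exact hGb p.1 p.2
  calc ∫ x, w x * Md P ε n (fun y => φ (y - x)) m
      = ∫ x, ∫ y, G x y ∂μn := by
        refine integral_congr_ae (ae_of_all _ fun x => ?_)
        dsimp only
        rw [Md, decPF, ← integral_const_mul]
        refine integral_congr_ae (ae_of_all _ fun y => ?_)
        rw [hG]; dsimp only; ring
    _ = ∫ y, ∫ x, G x y ∂volume ∂μn := integral_integral_swap hGi
    _ = Md P ε n (fun a => ∫ x, w x * φ (a - x)) m := by
        rw [Md, decPF]
        refine integral_congr_ae (ae_of_all _ fun y => ?_)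
        dsimp only
        rw [hG]; dsimp only
        rw [integral_mul_const]

/-- **The `x`-integral of the one-point numerators of the translates of a kernel of mass one is the
partition function**: `∫ M^{φ(·-x)}(m) dx = Ξ(m)`. -/
theorem integral_Md_translate_eq_Xi [NeZero n] (hφ : Continuous φ) (hφ1 : ∫ y, φ y = 1) (m : ℕ) :
    ∫ x, Md P ε n (fun y => φ (y - x)) m = Xi P ε n m := by
  have h := integral_mul_Md_translate (P := P) (ε := ε) (n := n) (w := fun _ => (1 : ℝ))
    continuous_const hφ m
  simp only [one_mul] at h
  rw [h]
  haveI := isNegInvariant_volume_T3'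
  have h1 : (fun a : T3 => ∫ x, φ (a - x)) = fun _ => (1 : ℝ) := by
    funext a
    rw [integral_sub_left_eq_self φ volume a, hφ1]
  rw [h1, Md_one]

/-- One-point form: `∫ w(x) E[φ(x₀ - x)] dx = E[(w ⋆ φ)(x₀)]` (shift `s`). -/
theorem integral_mul_onePt_translate {w : T3 → ℝ} (hw : Continuous w) (hφ : Continuous φ)
    (N s : ℕ) :
    ∫ x, w x * onePt P σ (fun y => φ (y - x)) N s =
      onePt P σ (fun a => ∫ x, w x * φ (a - x)) N s := by
  simp only [onePt]
  simp_rw [mul_div_assoc', integral_div]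
  rw [integral_mul_Md_translate hw hφ]

/-- `∫ E[φ(x₀ - x)] dx = 1` for a kernel of mass one (small density, so that `Ξ > 0`). -/
theorem integral_onePt_translate_eq_one (h : SmallDensity P σ) (hφ : Continuous φ)
    (hφ1 : ∫ y, φ y = 1) (N s : ℕ) :
    ∫ x, onePt P σ (fun y => φ (y - x)) N s = 1 := by
  have hXi := XiN_pos h.σ_pos.le h.σ_lt_half h.ovDensity_lt_one (N := N) (m := N + 1 - s)
    (Nat.sub_le _ _)
  simp only [onePt]
  rw [integral_div, integral_Md_translate_eq_Xi hφ hφ1, ← XiN, div_self hXi.ne']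

/-! ### The same-block remainder with two observables -/

/-- **The same-block remainder is `O(p_ε)`**, with two bounded observables:
`|same-block terms| / Ξ_N(N+1) ≤ 4 e² C C' S p_{ε_N}`, `S = θ/(1-θ)² + (1-θ)⁻¹` (the bound inside
`HardSphereEulerLLN.tendsto_sameBlockRem_div`, extracted). -/
theorem abs_sameBlockRem_div_le (h : SmallDensity P σ) {g₁ g₂ : T3 → ℝ} (hg₁ : Measurable g₁)
    (hg₂ : Measurable g₂) {C C' : ℝ} (hC : ∀ y, |g₁ y| ≤ C) (hC' : ∀ y, |g₂ y| ≤ C') (N : ℕ)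
    (h2 : 2 ≤ N + 1) :
    |sameBlockRem P (hsDiameter σ N) (N + 1) h2 g₁ g₂ / XiN P σ N (N + 1)| ≤
      4 * Real.exp 1 ^ 2 * (C * C') *
        (geomRatio P σ / (1 - geomRatio P σ) ^ 2 + (1 - geomRatio P σ)⁻¹) *
          pOv P (hsDiameter σ N) := by
  have hlam1 := h.ovDensity_lt_one
  have hθ0 := h.geomRatio_nonneg
  have hl0 := h.ovDensity_nonneg
  have hC0 : 0 ≤ C := (abs_nonneg _).trans (hC 0)
  have hC0' : 0 ≤ C' := (abs_nonneg _).trans (hC' 0)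
  set S := geomRatio P σ / (1 - geomRatio P σ) ^ 2 + (1 - geomRatio P σ)⁻¹ with hS
  have hS0 : 0 ≤ S := h.hasSum_succ_mul_geomRatio_pow.nonneg fun j => by positivity
  have hε0 := hsDiameter_nonneg' (σ := σ) h.σ_pos.le N
  have hε2 := hsDiameter_lt_half h.σ_pos.le h.σ_lt_half N
  have hp0 : 0 ≤ pOv P (hsDiameter σ N) := pOv_nonneg P hε0
  have hXi := XiN_pos h.σ_pos.le h.σ_lt_half hlam1 (N := N) (m := N + 1) le_rfl
  have hrem := abs_sameBlockRem_le (P := P) (n := N + 1) h2 hε0 hε2 hg₁ hg₂ hC hC'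
  rw [abs_div, abs_of_pos hXi, div_le_iff₀ hXi]
  refine hrem.trans ?_
  rw [mul_sum]
  have hterm : ∀ j ∈ range (N + 1 - 1), C * C' * (((N + 1 - 2).choose j : ℝ) *
      (treeNumber (j + 2) * pOv P (hsDiameter σ N) ^ (j + 1) *
        Xi P (hsDiameter σ N) (N + 1) (N + 1 - 2 - j))) ≤
      (4 * Real.exp 1 ^ 2 * (C * C') * pOv P (hsDiameter σ N) * XiN P σ N (N + 1)) *
        (((j : ℝ) + 1) * geomRatio P σ ^ j) := by
    intro j hj
    have hj' : j < N := by have := mem_range.mp hj; omega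
    have hratio : Xi P (hsDiameter σ N) (N + 1) (N + 1 - 2 - j) =
        rN P σ N (N + 1) (j + 2) * XiN P σ N (N + 1) := by
      rw [rN, div_mul_cancel₀ _ hXi.ne', XiN, show N + 1 - (j + 2) = N + 1 - 2 - j by omega]
    have hr0 : 0 ≤ rN P σ N (N + 1) (j + 2) :=
      zero_le_one.trans (one_le_rN h.σ_pos.le h.σ_lt_half hlam1 le_rfl (by omega))
    have hr2 := h.rN_le_two_pow (N := N) (m := N + 1) (j := j + 2) le_rfl (by omega)
    have hchoose : ((N + 1 - 2).choose j : ℝ) ≤ ((N + 1 - 2 : ℕ) : ℝ) ^ j / j.factorial :=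
      Nat.choose_le_pow_div j (N + 1 - 2)
    have hmp : ((N + 1 - 2 : ℕ) : ℝ) * pOv P (hsDiameter σ N) ≤ ovDensity P σ :=
      mul_pOv_le_ovDensity h.σ_pos.le (by omega)
    have htree := treeNumber_succ_succ_mul_pow_div_factorial_le hl0 j
    have hmain : ((N + 1 - 2).choose j : ℝ) * (treeNumber (j + 2) * pOv P (hsDiameter σ N) ^ (j + 1)) ≤
        Real.exp 1 ^ 2 * (j + 1) * (Real.exp 1 * ovDensity P σ) ^ j * pOv P (hsDiameter σ N) := by
      calc ((N + 1 - 2).choose j : ℝ) * (treeNumber (j + 2) * pOv P (hsDiameter σ N) ^ (j + 1))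
          ≤ (((N + 1 - 2 : ℕ) : ℝ) ^ j / j.factorial) *
              (treeNumber (j + 2) * pOv P (hsDiameter σ N) ^ (j + 1)) :=
            mul_le_mul_of_nonneg_right hchoose (by positivity)
        _ = (treeNumber (j + 2) * (((N + 1 - 2 : ℕ) : ℝ) * pOv P (hsDiameter σ N)) ^ j / j.factorial) *
              pOv P (hsDiameter σ N) := by rw [mul_pow]; ring
        _ ≤ (treeNumber (j + 2) * ovDensity P σ ^ j / j.factorial) * pOv P (hsDiameter σ N) := by
            gcongr
        _ ≤ Real.exp 1 ^ 2 * (j + 1) * (Real.exp 1 * ovDensity P σ) ^ j * pOv P (hsDiameter σ N) :=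
            mul_le_mul_of_nonneg_right htree hp0
    rw [hratio]
    calc C * C' * (((N + 1 - 2).choose j : ℝ) * (treeNumber (j + 2) * pOv P (hsDiameter σ N) ^ (j + 1) *
          (rN P σ N (N + 1) (j + 2) * XiN P σ N (N + 1))))
        = C * C' * ((((N + 1 - 2).choose j : ℝ) * (treeNumber (j + 2) * pOv P (hsDiameter σ N) ^ (j + 1))) *
            rN P σ N (N + 1) (j + 2)) * XiN P σ N (N + 1) := by ring
      _ ≤ C * C' * ((Real.exp 1 ^ 2 * (j + 1) * (Real.exp 1 * ovDensity P σ) ^ j * pOv P (hsDiameter σ N)) *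
            2 ^ (j + 2)) * XiN P σ N (N + 1) := by
          have hin := mul_le_mul hmain hr2 hr0 (by positivity)
          exact mul_le_mul_of_nonneg_right (mul_le_mul_of_nonneg_left hin (mul_nonneg hC0 hC0')) hXi.le
      _ = (4 * Real.exp 1 ^ 2 * (C * C') * pOv P (hsDiameter σ N) * XiN P σ N (N + 1)) *
            (((j : ℝ) + 1) * geomRatio P σ ^ j) := by rw [geomRatio]; ring
  refine (sum_le_sum hterm).trans ?_
  rw [← mul_sum]
  have hpart : ∑ j ∈ range (N + 1 - 1), ((j : ℝ) + 1) * geomRatio P σ ^ j ≤ S :=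
    sum_le_hasSum _ (fun j _ => by positivity) h.hasSum_succ_mul_geomRatio_pow
  calc (4 * Real.exp 1 ^ 2 * (C * C') * pOv P (hsDiameter σ N) * XiN P σ N (N + 1)) *
        ∑ j ∈ range (N + 1 - 1), ((j : ℝ) + 1) * geomRatio P σ ^ j
      ≤ (4 * Real.exp 1 ^ 2 * (C * C') * pOv P (hsDiameter σ N) * XiN P σ N (N + 1)) * S :=
        mul_le_mul_of_nonneg_left hpart (by positivity)
    _ = 4 * Real.exp 1 ^ 2 * (C * C') * S * pOv P (hsDiameter σ N) * XiN P σ N (N + 1) := by ring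

end

end Summit.AtomisticToContinuum.HydrodynamicLimit.Theorems.MesoLLN
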